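import Mathlib
import Literature.Analysis.FluidPDE.VectorCalculus
import Literature.Analysis.FluidPDE.LeiZhang2011Proofs

/-!
# Straight filaments in the rotating Leray frame: a regularised Biot–Savart bound and the absence of all-straight tangent skeletons

Route-independent helper file of the refutation-first lane `ns-filament-19175-p1` (crux
`TransverseReductionR`, stmt-NavierStokesRegularity-19175; consumed by
`FilamentSkeletonRssTransverseReductionRStraight.lean`, which turns it into the census line «the crux may
assume a positive curvature budget `K > 0`»).  No route file is imported here.

* `norm_integral_line_le` — the regularised Biot–Savart integral of a straight unit-speed filament,
  `∫ (‖y − X(σ)‖² + 1)^(−3/2) t × (y − X(σ)) dσ`, has norm `≤ π/d` at every point at distance `≥ d > 0`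
  from the line (comparison with `∫ dσ/((σ − σ₀)² + d²) = π/d`, `integral_inv_sq_add_sq`);
* `line_of_curv_nonpos` — `‖X″‖√Γ ≤ K ≤ 0` makes a `C²` unit-speed curve a straight line;
* `straight_box_absurd` — for `Γ ≥ exp(((Rw + C₁ + 1)/Rb)²)`,
  `C₁ = (N θ₀⁻¹/(4ρ) + (1/2 + θ₀⁻¹) Rw)/(θ₀ √(2θ₀ − θ₀²))`, no configuration of `N` straight, pairwise
  `ρ√Γ`-separated filaments with waists `≤ Rw√Γ`, tilt `|⟪t_j, e₃⟫| ≤ 1 − θ₀`, `θ₀ ≤ |α| ≤ θ₀⁻¹`,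
  `|γ_k| ≤ θ₀⁻¹` has the frame velocity `u + ½y − α e₃×y` (regularised Biot–Savart `u` with
  circulations `Γγ_k`) exactly tangent along a filament on the ball `‖y‖ ≤ Rb√(Γ log Γ)`.

Elementary (no analytic continuation); negative-side bookkeeping only — NOT a claim about NS regularity
or blow-up.
-/

set_option linter.dupNamespace false

noncomputable section

namespace Summit.NavierStokesRegularity.NavierStokesRegularity.Theorems

open Set Function Filter MeasureTheory Real
open Literature.Analysis.FluidPDE
open scoped InnerProductSpace Topology

namespace TransverseReductionRStraight

/-- `‖e₃ × t‖² = ‖t‖² − ⟪t, e₃⟫²` (Lagrange's identity with the unit vector `e₃`). [folklore] -/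
theorem norm_sq_cross_single_two (t : EuclideanSpace ℝ (Fin 3)) :
    ‖cross (EuclideanSpace.single 2 1) t‖ ^ 2 = ‖t‖ ^ 2 - ⟪t, EuclideanSpace.single 2 1⟫_ℝ ^ 2 := by
  rw [EuclideanSpace.norm_sq_eq, EuclideanSpace.norm_sq_eq, EuclideanSpace.inner_single_right]
  simp [cross, crossProduct, Fin.sum_univ_three]
  ring

/-- `‖q − r t‖² = (r − ⟪q, t⟫)² + (‖q‖² − ⟪q, t⟫²)` for a unit vector `t`: squared distance to a point
of the line `r ↦ r t` splits into the along-line and the perpendicular part. [folklore] -/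
theorem norm_sub_smul_sq (q t : EuclideanSpace ℝ (Fin 3)) (ht : ‖t‖ = 1) (r : ℝ) :
    ‖q - r • t‖ ^ 2 = (r - ⟪q, t⟫_ℝ) ^ 2 + (‖q‖ ^ 2 - ⟪q, t⟫_ℝ ^ 2) := by
  rw [norm_sub_sq_real, norm_smul, Real.norm_eq_abs, ht, mul_one, sq_abs, real_inner_smul_right]
  ring

/-- `∫_ℝ dσ / ((σ − σ₀)² + d²) = π / d` for `d > 0`, with integrability. [folklore] -/
theorem integral_inv_sq_add_sq {d : ℝ} (hd : 0 < d) (σ₀ : ℝ) :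
    Integrable (fun σ : ℝ => ((σ - σ₀) ^ 2 + d ^ 2)⁻¹) ∧
      ∫ σ : ℝ, ((σ - σ₀) ^ 2 + d ^ 2)⁻¹ = π / d := by
  have hd' : d ≠ 0 := hd.ne'
  have hfun : (fun σ : ℝ => ((σ - σ₀) ^ 2 + d ^ 2)⁻¹) =
      fun σ => (d ^ 2)⁻¹ * (1 + (d⁻¹ * (σ - σ₀)) ^ 2)⁻¹ := by
    funext σ
    rw [← mul_inv]
    congr 1
    field_simp
    ring
  rw [hfun]
  have hint : Integrable (fun σ : ℝ => (1 + (d⁻¹ * (σ - σ₀)) ^ 2)⁻¹) :=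
    (integrable_inv_one_add_sq.comp_mul_left' (inv_ne_zero hd')).comp_sub_right σ₀
  refine ⟨hint.const_mul _, ?_⟩
  rw [integral_const_mul, integral_sub_right_eq_self (fun t => (1 + (d⁻¹ * t) ^ 2)⁻¹) σ₀,
    Measure.integral_comp_mul_left (fun u => (1 + u ^ 2)⁻¹) d⁻¹, integral_univ_inv_one_add_sq,
    inv_inv, abs_of_pos hd, smul_eq_mul]
  field_simp

/-- **Straight-line regularised Biot–Savart bound.** For a unit direction `t`, the regularised
Biot–Savart integrand of the straight filament `σ ↦ P + (σ − c) t` (kernel `(‖·‖² + 1)^(−3/2)`), evaluated at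
a point `y` at distance `≥ d > 0` from every point of the line, has integral of norm `≤ π / d`:
`‖∫ (‖y − X(σ)‖² + 1)^(−3/2) t × (y − X(σ)) dσ‖ ≤ ∫ dσ / ((σ − σ₀)² + d²) = π / d`. [folklore] -/
theorem norm_integral_line_le {P t y : EuclideanSpace ℝ (Fin 3)} {c d : ℝ} (ht : ‖t‖ = 1) (hd : 0 < d)
    (hfar : ∀ σ : ℝ, d ≤ ‖y - (P + (σ - c) • t)‖) :
    ‖∫ σ : ℝ, ((‖y - (P + (σ - c) • t)‖ ^ 2 + 1) ^ (3/2:ℝ))⁻¹ • cross t (y - (P + (σ - c) • t))‖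
      ≤ π / d := by
  set q := y - P with hq
  set σ₀ := c + ⟪q, t⟫_ℝ with hσ₀
  have hΔ : ∀ σ : ℝ, y - (P + (σ - c) • t) = q - (σ - c) • t := fun σ => by rw [hq]; abel
  have hsq : ∀ σ : ℝ, ‖q - (σ - c) • t‖ ^ 2 = (σ - σ₀) ^ 2 + (‖q‖ ^ 2 - ⟪q, t⟫_ℝ ^ 2) := fun σ => by
    rw [norm_sub_smul_sq q t ht, hσ₀]; ring
  have hD : d ^ 2 ≤ ‖q‖ ^ 2 - ⟪q, t⟫_ℝ ^ 2 := by
    have h := hfar σ₀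
    rw [hΔ] at h
    have h2 : d ^ 2 ≤ ‖q - (σ₀ - c) • t‖ ^ 2 := pow_le_pow_left₀ hd.le h 2
    rw [hsq] at h2
    simpa using h2
  obtain ⟨hgi, hgv⟩ := integral_inv_sq_add_sq hd σ₀
  rw [← hgv]
  refine norm_integral_le_of_norm_le hgi (Eventually.of_forall fun σ => ?_)
  rw [hΔ]
  set Δ := q - (σ - c) • t with hΔdef
  have hA : 0 < ‖Δ‖ ^ 2 + 1 := by positivity
  have hlow : (σ - σ₀) ^ 2 + d ^ 2 ≤ ‖Δ‖ ^ 2 := by rw [hΔdef, hsq]; linarith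
  have hpos : 0 < (σ - σ₀) ^ 2 + d ^ 2 := by positivity
  rw [norm_smul, norm_inv, Real.norm_eq_abs, abs_of_pos (Real.rpow_pos_of_pos hA _)]
  have h32 : (‖Δ‖ ^ 2 + 1) ^ (3/2:ℝ) = (‖Δ‖ ^ 2 + 1) * √(‖Δ‖ ^ 2 + 1) := by
    rw [show (3/2:ℝ) = 1 + 1/2 by norm_num, Real.rpow_add hA, Real.rpow_one, Real.sqrt_eq_rpow]
  have hΔle : ‖Δ‖ ≤ √(‖Δ‖ ^ 2 + 1) :=
    calc ‖Δ‖ = √(‖Δ‖ ^ 2) := (Real.sqrt_sq (norm_nonneg _)).symm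
      _ ≤ √(‖Δ‖ ^ 2 + 1) := Real.sqrt_le_sqrt (by linarith)
  have hs : 0 < √(‖Δ‖ ^ 2 + 1) := Real.sqrt_pos.2 hA
  calc ((‖Δ‖ ^ 2 + 1) ^ (3/2:ℝ))⁻¹ * ‖cross t Δ‖
      ≤ ((‖Δ‖ ^ 2 + 1) ^ (3/2:ℝ))⁻¹ * ‖Δ‖ := by
        gcongr
        calc ‖cross t Δ‖ ≤ ‖t‖ * ‖Δ‖ := norm_cross_le_norm_mul_norm t Δ
          _ = ‖Δ‖ := by rw [ht, one_mul]
    _ ≤ ((‖Δ‖ ^ 2 + 1) ^ (3/2:ℝ))⁻¹ * √(‖Δ‖ ^ 2 + 1) := by gcongr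
    _ = (‖Δ‖ ^ 2 + 1)⁻¹ := by
        rw [h32]
        field_simp
    _ ≤ ((σ - σ₀) ^ 2 + d ^ 2)⁻¹ := by
        apply inv_anti₀ hpos
        linarith

/-- A `C²` curve with `‖X″‖ √Γ ≤ K ≤ 0` (`Γ > 0`) is the straight line `X(τ) = X(c) + (τ − c) X′(c)`
with constant unit tangent. [folklore] -/
theorem line_of_curv_nonpos {K Γ : ℝ} (hΓ : 0 < Γ) (hK : K ≤ 0) {X : ℝ → EuclideanSpace ℝ (Fin 3)}
    (hX : ContDiff ℝ 2 X) (hcurv : ∀ τ, ‖iteratedDeriv 2 X τ‖ * √Γ ≤ K) (c : ℝ) :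
    (∀ τ, deriv X τ = deriv X c) ∧ ∀ τ, X τ = X c + (τ - c) • deriv X c := by
  have hs : 0 < √Γ := Real.sqrt_pos.2 hΓ
  have h2 : ∀ τ, deriv (deriv X) τ = 0 := fun τ => by
    have h := (hcurv τ).trans hK
    rw [show iteratedDeriv 2 X = deriv (deriv X) from by
      rw [iteratedDeriv_eq_iterate]; rfl] at h
    have : ‖deriv (deriv X) τ‖ ≤ 0 := by
      by_contra hc
      exact absurd h (not_le.2 (mul_pos (not_le.1 hc) hs))
    exact norm_le_zero_iff.1 this
  have hderiv : ∀ τ, deriv X τ = deriv X c := by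
    have hd : Differentiable ℝ (deriv X) := by
      have := hX.differentiable_iteratedDeriv 1 (by norm_num)
      rwa [iteratedDeriv_one] at this
    intro τ
    exact is_const_of_deriv_eq_zero hd h2 τ c
  have hdX : Differentiable ℝ X := hX.differentiable (by norm_num)
  refine ⟨hderiv, ?_⟩
  have hdg' : ∀ s, HasDerivAt (fun s => X s - s • deriv X c) 0 s := fun s => by
    have h1 : HasDerivAt X (deriv X c) s := hderiv s ▸ (hdX s).hasDerivAt
    have h2 : HasDerivAt (fun s : ℝ => s • deriv X c) (deriv X c) s := by
      simpa using (hasDerivAt_id s).smul_const (deriv X c)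
    simpa using h1.fun_sub h2
  have hdg : ∀ s, deriv (fun s => X s - s • deriv X c) s = 0 := fun s => (hdg' s).deriv
  have hdiff : Differentiable ℝ (fun s => X s - s • deriv X c) := fun s => (hdg' s).differentiableAt
  intro τ
  have := is_const_of_deriv_eq_zero hdiff hdg τ c
  have h' : X τ = X c - c • deriv X c + τ • deriv X c := by
    rw [← this]; abel
  rw [h', sub_smul]; abel

/-- **No all-straight tilted skeleton box at large `Γ`.** For `Γ ≥ exp(((Rw + C₁ + 1)/Rb)²)` no
configuration of `N` STRAIGHT unit-speed filaments `X_k(τ) = P_k + (τ − c_k) t_k`, pairwise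
`ρ√Γ`-separated, with `‖P_j‖ ≤ Rw√Γ`, tilt `|⟪t_j, e₃⟫| ≤ 1 − θ₀`, `θ₀ ≤ |α| ≤ θ₀⁻¹`, `|γ_k| ≤ θ₀⁻¹`,
has `v = u + ½y − α e₃×y` tangent along filament `j` on the ball `‖y‖ ≤ Rb√(Γ log Γ)`: pair the
tangency equation at `τ* = c_j + (C₁ + 1)√Γ` with `e = e₃ × t_j` (`‖e‖² ≥ 2θ₀ − θ₀²`); the rotation
gives `α (τ* − c_j) ‖e‖²`, the drift `½⟪P_j, e⟫`, the self-induction vanishes and every other filament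
contributes `≤ Γ|γ_k|/(4π) · π/(ρ√Γ)` (`norm_integral_line_le`) ⇒ `|τ* − c_j| ≤ C₁√Γ`, absurd. [folklore] -/
theorem straight_box_absurd {N : ℕ} {ρ Rw Rb θ₀ : ℝ} (hN : 0 < N) (hρ : 0 < ρ) (hRw : 0 < Rw)
    (hRb : 0 < Rb) (hθ₀ : 0 < θ₀) :
    ∃ Γ₁ : ℝ, 1 ≤ Γ₁ ∧ ∀ Γ : ℝ, Γ₁ ≤ Γ → ∀ (αp : ℝ) (γ : Fin N → ℝ)
      (X : Fin N → ℝ → EuclideanSpace ℝ (Fin 3)) (w : Fin N → ℝ → ℝ) (c : Fin N → ℝ)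
      (u : (Fin N → ℝ → EuclideanSpace ℝ (Fin 3)) → EuclideanSpace ℝ (Fin 3) → EuclideanSpace ℝ (Fin 3))
      (v : EuclideanSpace ℝ (Fin 3) → EuclideanSpace ℝ (Fin 3)),
      (∀ Z y, u Z y = ∑ k, (Γ * γ k / (4 * Real.pi)) • ∫ σ : ℝ, ((‖y - Z k σ‖ ^ 2 + 1) ^ (3/2:ℝ))⁻¹ •
        cross (deriv (Z k) σ) (y - Z k σ)) →
      (∀ y, v y = u X y + (1/2:ℝ) • y - αp • cross (EuclideanSpace.single 2 1) y) →
      (∀ k τ, deriv (X k) τ = deriv (X k) (c k)) →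
      (∀ k τ, X k τ = X k (c k) + (τ - c k) • deriv (X k) (c k)) →
      (∀ k, ‖deriv (X k) (c k)‖ = 1) →
      (∀ j k, j ≠ k → ∀ τ σ, ρ * √Γ ≤ ‖X j τ - X k σ‖) →
      (∀ j τ, ‖X j τ‖ ≤ Rb * √(Γ * Real.log Γ) → v (X j τ) = w j τ • deriv (X j) τ) →
      (∀ j, ‖X j (c j)‖ ≤ Rw * √Γ) →
      (∀ j, |⟪deriv (X j) (c j), EuclideanSpace.single 2 1⟫_ℝ| ≤ 1 - θ₀) →
      θ₀ ≤ |αp| → |αp| ≤ θ₀⁻¹ → (∀ k, |γ k| ≤ θ₀⁻¹) → False := by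
  set s₀ : ℝ := √(2 * θ₀ - θ₀ ^ 2) with hs₀_def
  set C₁ : ℝ := ((N:ℝ) * (θ₀⁻¹ / (4 * ρ)) + (1/2 + θ₀⁻¹) * Rw) / (θ₀ * s₀) with hC₁_def
  refine ⟨Real.exp (((Rw + C₁ + 1) / Rb) ^ 2), Real.one_le_exp (sq_nonneg _),
    fun Γ hΓ αp γ X w c u v hu hv hderiv hline hunit hsep htan hwaist htilt hα hα' hγ => ?_⟩
  have hΓ0 : 0 < Γ := by linarith [le_trans (Real.one_le_exp (sq_nonneg _)) hΓ]
  have hs : 0 < √Γ := Real.sqrt_pos.2 hΓ0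
  set j : Fin N := ⟨0, hN⟩ with hj
  have hθ1 : θ₀ ≤ 1 := by have := (abs_nonneg _).trans (htilt j); linarith
  have hm : 0 < 2 * θ₀ - θ₀ ^ 2 := by nlinarith
  have hs₀ : 0 < s₀ := Real.sqrt_pos.2 hm
  have hC₁ : 0 ≤ C₁ := by rw [hC₁_def]; positivity
  set t := deriv (X j) (c j) with ht_def
  set P := X j (c j) with hP_def
  set e := cross (EuclideanSpace.single 2 1) t with he_def
  have he2 : 2 * θ₀ - θ₀ ^ 2 ≤ ‖e‖ ^ 2 := by
    rw [he_def, norm_sq_cross_single_two, hunit j]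
    have h1 := abs_le.1 (htilt j)
    nlinarith [h1.1, h1.2]
  have hes : s₀ ≤ ‖e‖ :=
    calc s₀ = √(2 * θ₀ - θ₀ ^ 2) := rfl
      _ ≤ √(‖e‖ ^ 2) := Real.sqrt_le_sqrt he2
      _ = ‖e‖ := Real.sqrt_sq (norm_nonneg _)
  have he0 : 0 < ‖e‖ := lt_of_lt_of_le hs₀ hes
  set r : ℝ := (C₁ + 1) * √Γ with hr_def
  have hr : 0 < r := by positivity
  set τs : ℝ := c j + r with hτs_def
  have hXτ : X j τs = P + r • t := by rw [hline j τs, show τs - c j = r by rw [hτs_def]; ring]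
  have hball : ‖X j τs‖ ≤ Rb * √(Γ * Real.log Γ) := by
    rw [hXτ]
    have h1 : ((Rw + C₁ + 1) / Rb) ^ 2 ≤ Real.log Γ := (Real.le_log_iff_exp_le hΓ0).2 hΓ
    have h2 : (Rw + C₁ + 1) / Rb ≤ √(Real.log Γ) :=
      calc (Rw + C₁ + 1) / Rb = √(((Rw + C₁ + 1) / Rb) ^ 2) := (Real.sqrt_sq (by positivity)).symm
        _ ≤ √(Real.log Γ) := Real.sqrt_le_sqrt h1
    calc ‖P + r • t‖ ≤ ‖P‖ + ‖r • t‖ := norm_add_le _ _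
      _ = ‖P‖ + r := by rw [norm_smul, Real.norm_eq_abs, abs_of_pos hr, hunit j, mul_one]
      _ ≤ Rw * √Γ + r := by rw [hP_def]; gcongr; exact hwaist j
      _ = (Rb * ((Rw + C₁ + 1) / Rb)) * √Γ := by rw [hr_def]; field_simp; ring
      _ ≤ (Rb * √(Real.log Γ)) * √Γ := by gcongr
      _ = Rb * √(Γ * Real.log Γ) := by rw [Real.sqrt_mul hΓ0.le]; ring
  have hU : ‖u X (X j τs)‖ ≤ (N:ℝ) * (√Γ * (θ₀⁻¹ / (4 * ρ))) := by
    rw [hu]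
    calc ‖∑ k, (Γ * γ k / (4 * Real.pi)) • ∫ σ : ℝ, ((‖X j τs - X k σ‖ ^ 2 + 1) ^ (3/2:ℝ))⁻¹ •
            cross (deriv (X k) σ) (X j τs - X k σ)‖
        ≤ ∑ k, ‖(Γ * γ k / (4 * Real.pi)) • ∫ σ : ℝ, ((‖X j τs - X k σ‖ ^ 2 + 1) ^ (3/2:ℝ))⁻¹ •
            cross (deriv (X k) σ) (X j τs - X k σ)‖ := norm_sum_le _ _
      _ ≤ ∑ _k : Fin N, √Γ * (θ₀⁻¹ / (4 * ρ)) := Finset.sum_le_sum fun k _ => ?_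
      _ = (N:ℝ) * (√Γ * (θ₀⁻¹ / (4 * ρ))) := by
          rw [Finset.sum_const, Finset.card_univ, Fintype.card_fin, nsmul_eq_mul]
    by_cases hkj : k = j
    · -- the self-induction of a straight filament vanishes on the filament
      have hzero : (fun σ : ℝ => ((‖X j τs - X k σ‖ ^ 2 + 1) ^ (3/2:ℝ))⁻¹ •
          cross (deriv (X k) σ) (X j τs - X k σ)) = fun _ => 0 := by
        funext σ
        rw [hkj, hderiv j σ, hline j σ, hXτ, ← ht_def, ← hP_def]
        have : P + r • t - (P + (σ - c j) • t) = (r - (σ - c j)) • t := by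
          rw [add_sub_add_left_eq_sub, ← sub_smul]
        rw [this, ← crossCLM_apply, map_smul, crossCLM_apply, show cross t t = 0 by simp [cross],
          smul_zero, smul_zero]
      rw [hzero, integral_zero, smul_zero, norm_zero]
      positivity
    · have hfun : (fun σ : ℝ => ((‖X j τs - X k σ‖ ^ 2 + 1) ^ (3/2:ℝ))⁻¹ •
          cross (deriv (X k) σ) (X j τs - X k σ)) = fun σ : ℝ =>
          ((‖X j τs - (X k (c k) + (σ - c k) • deriv (X k) (c k))‖ ^ 2 + 1) ^ (3/2:ℝ))⁻¹ •
          cross (deriv (X k) (c k)) (X j τs - (X k (c k) + (σ - c k) • deriv (X k) (c k))) := by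
        funext σ
        rw [hderiv k σ, ← hline k σ]
      have hfar : ∀ σ : ℝ, ρ * √Γ ≤ ‖X j τs - (X k (c k) + (σ - c k) • deriv (X k) (c k))‖ :=
        fun σ => by rw [← hline k σ]; exact hsep j k (Ne.symm hkj) τs σ
      have hI := norm_integral_line_le (hunit k) (mul_pos hρ hs) hfar
      rw [hfun, norm_smul, Real.norm_eq_abs, abs_div, abs_mul, abs_of_pos hΓ0,
        abs_of_pos (by positivity : (0:ℝ) < 4 * Real.pi)]
      calc Γ * |γ k| / (4 * Real.pi) * ‖∫ σ : ℝ, ((‖X j τs - (X k (c k) + (σ - c k) •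
              deriv (X k) (c k))‖ ^ 2 + 1) ^ (3/2:ℝ))⁻¹ • cross (deriv (X k) (c k))
              (X j τs - (X k (c k) + (σ - c k) • deriv (X k) (c k)))‖
          ≤ Γ * θ₀⁻¹ / (4 * Real.pi) * (Real.pi / (ρ * √Γ)) := by gcongr; exact hγ k
        _ = √Γ * (θ₀⁻¹ / (4 * ρ)) := by
            have hπ : Real.pi ≠ 0 := Real.pi_pos.ne'
            rw [show Γ * θ₀⁻¹ / (4 * Real.pi) * (Real.pi / (ρ * √Γ)) = (Γ / √Γ) * (θ₀⁻¹ / (4 * ρ)) by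
              field_simp, Real.div_sqrt]
  have hT := htan j τs hball
  rw [hv, hderiv j τs, ← ht_def] at hT
  have hte : ⟪t, e⟫_ℝ = 0 := by
    rw [he_def]
    simp [cross, crossProduct, PiLp.inner_apply, Fin.sum_univ_three]
    ring
  have hcross : cross (EuclideanSpace.single 2 1) (X j τs) =
      cross (EuclideanSpace.single 2 1) P + r • e := by
    rw [hXτ, ← crossCLM_apply, map_add, map_smul]; rfl
  have hXe : ⟪X j τs, e⟫_ℝ = ⟪P, e⟫_ℝ := by
    rw [hXτ, inner_add_left, real_inner_smul_left, hte, mul_zero, add_zero]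
  have hE := congrArg (fun z => ⟪z, e⟫_ℝ) hT
  simp only [inner_sub_left, inner_add_left, real_inner_smul_left, hte, mul_zero, hcross, hXe,
    real_inner_self_eq_norm_sq] at hE
  have hkey : αp * r * ‖e‖ ^ 2 = ⟪u X (X j τs), e⟫_ℝ + 1/2 * ⟪P, e⟫_ℝ -
      αp * ⟪cross (EuclideanSpace.single 2 1) P, e⟫_ℝ := by linarith
  have hb1 : |⟪u X (X j τs), e⟫_ℝ| ≤ ‖u X (X j τs)‖ * ‖e‖ := abs_real_inner_le_norm _ _
  have hb3 : |⟪cross (EuclideanSpace.single 2 1) P, e⟫_ℝ| ≤ ‖P‖ * ‖e‖ := by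
    refine (abs_real_inner_le_norm _ _).trans ?_
    gcongr
    calc ‖cross (EuclideanSpace.single 2 1) P‖ ≤ ‖EuclideanSpace.single (2 : Fin 3) (1:ℝ)‖ * ‖P‖ :=
          norm_cross_le_norm_mul_norm _ _
      _ = ‖P‖ := by simp
  have habs : |αp| * r * ‖e‖ ^ 2 ≤ (‖u X (X j τs)‖ + (1/2 + |αp|) * ‖P‖) * ‖e‖ := by
    have h0 : |αp| * r * ‖e‖ ^ 2 = |αp * r * ‖e‖ ^ 2| := by
      rw [abs_mul, abs_mul, abs_of_pos hr, abs_of_nonneg (sq_nonneg ‖e‖)]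
    rw [h0, hkey]
    have hαP : |αp * ⟪cross (EuclideanSpace.single 2 1) P, e⟫_ℝ| ≤ |αp| * (‖P‖ * ‖e‖) := by
      rw [abs_mul]; gcongr
    have h12 : |1/2 * ⟪P, e⟫_ℝ| ≤ 1/2 * (‖P‖ * ‖e‖) := by
      rw [abs_mul, abs_of_pos (by norm_num : (0:ℝ) < 1/2)]
      exact mul_le_mul_of_nonneg_left (abs_real_inner_le_norm _ _) (by norm_num)
    calc |⟪u X (X j τs), e⟫_ℝ + 1/2 * ⟪P, e⟫_ℝ - αp * ⟪cross (EuclideanSpace.single 2 1) P, e⟫_ℝ|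
        ≤ |⟪u X (X j τs), e⟫_ℝ + 1/2 * ⟪P, e⟫_ℝ| + |αp * ⟪cross (EuclideanSpace.single 2 1) P, e⟫_ℝ| :=
          abs_sub _ _
      _ ≤ (|⟪u X (X j τs), e⟫_ℝ| + |1/2 * ⟪P, e⟫_ℝ|) + |αp| * (‖P‖ * ‖e‖) := by
          gcongr; exact abs_add_le _ _
      _ ≤ (‖u X (X j τs)‖ * ‖e‖ + 1/2 * (‖P‖ * ‖e‖)) + |αp| * (‖P‖ * ‖e‖) := by gcongr
      _ = (‖u X (X j τs)‖ + (1/2 + |αp|) * ‖P‖) * ‖e‖ := by ring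
  have hdiv : |αp| * r * ‖e‖ ≤ ‖u X (X j τs)‖ + (1/2 + |αp|) * ‖P‖ := by
    have := habs
    rw [pow_two, ← mul_assoc] at this
    exact le_of_mul_le_mul_right this he0
  have hlow : θ₀ * r * s₀ ≤ |αp| * r * ‖e‖ := by gcongr
  have hup : ‖u X (X j τs)‖ + (1/2 + |αp|) * ‖P‖ ≤
      (N:ℝ) * (√Γ * (θ₀⁻¹ / (4 * ρ))) + (1/2 + θ₀⁻¹) * (Rw * √Γ) :=
    add_le_add hU (mul_le_mul (by linarith) (hwaist j) (norm_nonneg _) (by positivity))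
  have hnum : (N:ℝ) * (√Γ * (θ₀⁻¹ / (4 * ρ))) + (1/2 + θ₀⁻¹) * (Rw * √Γ) = θ₀ * (C₁ * √Γ) * s₀ := by
    rw [hC₁_def]
    field_simp
  have hfin : θ₀ * r * s₀ ≤ θ₀ * (C₁ * √Γ) * s₀ := hnum ▸ hlow.trans (hdiv.trans hup)
  have hexp : θ₀ * r * s₀ = θ₀ * (C₁ * √Γ) * s₀ + θ₀ * √Γ * s₀ := by rw [hr_def]; ring
  linarith [show (0:ℝ) < θ₀ * √Γ * s₀ by positivity]

end TransverseReductionRStraight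

end Summit.NavierStokesRegularity.NavierStokesRegularity.Theorems
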